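import Summits.Ventures.GridStability.Bench.SMIBCctThresholdReplayGlue
import Summits.Ventures.GridStability.Bench.SMIBDeg4ARecertD2K13postD10RecastEntry
import Literature.Computation.Certificates.CapOdeDoubletonReplayPostFault

/-!
# Bench/SMIBCctThreshold117 — «CCT(M′_SMIB) ≥ 0.117 s in THRESHOLD sense, KERNEL-ONLY» (line G1cct-SMIB-THRESH-117-K, boxes L1–L4 composed)

Cell `gridfusion` (LADDER-GRIDFUSION G1-cct; lead RULING R-CCT-THRESH-SMIB-117K; certnum RQ-016), seat
gridfusion-model-1 (box L4).  Instantiation of `SMIBCct.cct_threshold_of_kernelReplay` (p505931) with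
certnum's post-fault KERNEL REPLAY `Literature.Computation.Certificates.CapOdeDoubletonReplayPostFault`
(RQ-016, p-ids on the certnum ledger: field identity `smibK13PostFault_fieldFun`, a-priori angle CEILING
`smibK13PostFault_ceiling` (`δ ≤ 1187407742020143/562949953421312 ≈ 2.10926` on `[0, T_p]`), entry `smibK13PostFault_entry`
at `T_p = 483/1000` (absolute 0.6 s), end-box angle `smibK13PostFault_final_component0`, well inequality `smibK13PostFault_wellPoly_le` = sos-3's recast
sublevel polynomial `G(sin d, cos d, ω) ≤ 49/50` on the end box, decided by kernel interval evaluation) and the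
identity `V(sin(d − δˢ), 1 − cos(d − δˢ), ω) = G(sin d, cos d, ω)` (`V_eq_wellG`, `ring` with the exact circle
point `sin δˢ = s*`, `cos δˢ = c*`; recast inequality file cert/sos-3/cct/smib/K13postD10-lsmax-recast-inequality.json
sha16 a15c2f1d65c018de).  CHAIN: fault-on kernel replay p501311 (0 → 0.117 s) ⊕ SMIB clearing-time THRESHOLD
theorem p502590/p503187 (orbit monotonicity) ⊕ post-fault kernel replay RQ-016 (0.117 → 0.6 s) ⊕ deg-4 SOS ROA
p480553 (γ = 49/50).  MODELLED: classical SMIB M′ = «SMIB-K13post-D10» (MV-1 + MV-P + MV-KD: `K13postD10`,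
P_max = E′E_B/X = 1.1024, P_m = 0.9, H = 3.5, K_D = 10), zero-power three-phase fault with the `K_D = 10` damping
in force (`K13fault (10/377)`), pre-fault angle in the fault-on replay's initial interval (⊂ [0.7290, 0.7291],
printed 41.77°), ω₀ = 0.  TRUSTED BASE: the Lean kernel only — no enclosure engine, no float.  THREE COLUMNS,
never merged: CERTIFIED (this file) «every t_cl ∈ [0, 0.117 s] resynchronises» beside #19 «≥ 0.112 s (SOS
threshold certificate)», the VALIDATED∘ENCLOSURE bracket [0.117, 0.1175) s, and the kernel pole-slip side
«every t_cl ∈ [0.135, 0.24] s slips» (p506640/p509597).  No sentence here says a machine or a grid is stable.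
[cite: Kundur1994, §13.1.3 and Example 13.1; SauerPai1998, §9.6.3 (9.48); Moore1979, §8.1]
-/

noncomputable section

open Real Set Filter Topology NonemptyInterval Matrix
open Literature.Analysis.ValidatedNumerics
open Literature.Analysis.ODE Literature.Analysis.ODE.FExpr
open Literature.Computation.Certificates.CapOdeDoubletonReplay

namespace Summit.Ventures.GridStability.Bench.SMIBCct

/-- **The recast identity**: the deg-4 certificate's `V` at the recast state `(sin(d − δˢ), 1 − cos(d − δˢ), ω)`
IS certnum's well-entry code list `smibK13PostFaultWellG` (sos-3's 35-term `G(sin d, cos d, ω)`) evaluated at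
`(d, ω)` — exact, by `ring` with `sin δˢ = s*`, `cos δˢ = c*`. -/
theorem V_eq_wellG (y : Fin 2 → ℝ) :
    SMIB.deg4_A_recertD2_K13postD10_V (Real.sin (y 0 - Models.SMIB.deltaK13))
        (1 - Real.cos (y 0 - Models.SMIB.deltaK13)) (y 1) = smibK13PostFaultWellG.eval y := by
  rw [smibK13PostFaultWellG_eval, SMIB.recastEntry_sigma, SMIB.recastEntry_kappa,
    SMIB.deg4_A_recertD2_K13postD10_V_eq]
  simp only [Models.SMIB.sStar, Models.SMIB.cStar]
  push_cast
  ring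

/-- The end box of the post-fault replay lies in the entry set of the deg-4 ROA theorem: `V ≤ 49/50` (certnum's
kernel interval evaluation of `G`, `smibK13PostFault_wellPoly_le`, transported by `V_eq_wellG`) and `|d − δˢ| < π`
(end-box angle ∈ [2.10908, 2.10909] by `smibK13PostFault_final_component0`, `δˢ ∈ (0.9551, 0.9552)`). -/
theorem endBox_subset_well (y : Fin 2 → ℝ) (hy : y ∈ boxSet (castBox smibK13PostFaultInstance.final)) :
    SMIB.deg4_A_recertD2_K13postD10_V (Real.sin (y 0 - Models.SMIB.deltaK13))
        (1 - Real.cos (y 0 - Models.SMIB.deltaK13)) (y 1) ≤ 49 / 50 ∧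
      |y 0 - Models.SMIB.deltaK13| < π := by
  have hG := smibK13PostFault_wellPoly_le hy
  rw [← smibK13PostFaultWellG_eval] at hG
  obtain ⟨hlo, hhi⟩ := smibK13PostFault_final_component0 hy
  have hδ1 := Models.SMIB.deltaK13_gt
  have hδ2 := Models.SMIB.deltaK13_lt
  have hπ := Real.pi_gt_three
  constructor
  · rw [V_eq_wellG]
    exact hG.trans (by norm_num)
  · rw [abs_lt]
    norm_num at hlo hhi hδ1 hδ2 ⊢
    constructor <;> linarith

/-- **CCT(M′_SMIB) ≥ 0.117 s in THRESHOLD sense, KERNEL-ONLY.**  For every fault-on motion `Y` of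
`SMIB.K13fault (10/377)` on `[0, 0.117]` from the replay's initial angle interval with `ω(0) = 0` and every
clearing instant `t′ ∈ [0, 0.117 s]`: a post-fault solution of `SMIB.K13postD10` from `Y t′` exists on every
`[0, S]`, and EVERY such solution keeps `δ(s) ∈ (−π − δˢ, π − δˢ)` for all `s ≥ 0` (no pole slip) and tends to
`(δˢ, 0)` (resynchronisation).  MODELLED M′ as in the header; kernel-only.
[cite: Kundur1994, §13.1.3 and Example 13.1; SauerPai1998, §9.6.3 (9.48)] -/
theorem smib_cct_threshold_0117 {Y : ℝ → ℝ × ℝ}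
    (hY : (Models.SMIB.K13fault (10 / 377)).IsSolutionOn Y (Icc 0 (117 / 1000)))
    (hY0 : (Y 0).1 ∈ Icc (((420253739949835307 / 576460752303423488 : ℚ) : ℝ))
      (((840507479899670615 / 1152921504606846976 : ℚ) : ℝ)))
    (hω0 : (Y 0).2 = 0) {t' : ℝ} (ht' : t' ∈ Icc (0 : ℝ) (117 / 1000)) :
    (∃ X : ℝ → ℝ × ℝ, X 0 = Y t' ∧ ∀ S : ℝ, Models.SMIB.K13postD10.IsSolutionOn X (Icc 0 S)) ∧
    ∀ X : ℝ → ℝ × ℝ, X 0 = Y t' → (∀ S : ℝ, Models.SMIB.K13postD10.IsSolutionOn X (Icc 0 S)) →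
      (∀ s, 0 ≤ s → (X s).1 ∈ Ioo (-π - Models.SMIB.deltaK13) (π - Models.SMIB.deltaK13)) ∧
      Tendsto X atTop (𝓝 (Models.SMIB.deltaK13, 0)) :=
  cct_threshold_of_kernelReplay smibK13PostFault_fieldFun
    (A := (((1187407742020143 / 562949953421312 : ℚ)) : ℝ)) (by norm_num)
    smibK13PostFault_ceiling (tK := (483 / 1000 : ℝ)) ⟨by norm_num, le_rfl⟩ smibK13PostFault_entry
    endBox_subset_well hY hY0 hω0 ht'

end Summit.Ventures.GridStability.Bench.SMIBCct

end
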